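import Literature.NumberTheory.Rogawski1990.CartanTorusTransport        -- ★ (B5) p851648: `⋆`-compatible transport, class criterion, centraliser bookkeeping
import Literature.NumberTheory.Rogawski1990.CartanIndex                 -- ★ `cartanInvolution`, `coe_cartanInvolution` (+ ★ `HermitianAdjointCartanAlgebra`)
import Literature.LinearAlgebra.Matrix.SeparableCommutantConjugate     -- ★ (B3) p851644: `exists_gl_conj_eq_algEquiv_adjoin`
import HarnessLib

/-!
# Finitely many `U(H)`-conjugacy classes of Cartan subgroups — the ASSEMBLY over the one-place model (Rogawski 1990 §3.6; Platonov–Rapinchuk §6.4 Cor. 1 of Thm. 6.14)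

Topic `NumberTheory/Rogawski1990`; namespace `Literature.NumberTheory.Rogawski1990`.  THEOREMS ONLY (no definition, no instance, no notation, no named fact, no
`sorry`); universe `Type` (★ `CartanIndex` letters).  Cell `pub/hodgecm-mathlib`, crux H413 = `stmt-HodgeConjecture-24833` (supports-only lane), line LH6 «StCharTS», (S-𝔇)
datum road, brick (B7a) «ASSEMBLY» of the p03 lineage's «CARTAN-FIN (N1)» road.

THE MATHEMATICS.  `U = U(H)(L) ≤ GL_N(L)` (★ `ShimuraVarieties.unitaryGroup σ H`, `σ` an involution of the field `L` fixing `F`, `H` `σ`-hermitian invertible), `⋆ = hermStar σ H`.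
A CARTAN SUBGROUP is `Z_U(γ)` for `γ ∈ U` regular semisimple; its Cartan algebra is `(L[γ], τ_γ)` with `τ_γ = ⋆|_{L[γ]}` (★ `cartanInvolution`).  Two inputs, taken here as
CLOSED HYPOTHESES and discharged by the sibling bricks of the road:
* (TYPES) finitely many Cartan algebras up to `L`-isomorphism WITH INVOLUTION: a finite `Γ ⊆ U` of regular elements such that every regular `γ ∈ U` has
  `(L[γ₀], τ₀) ≃ₐ[L] (L[γ], τ_γ)` for some `γ₀ ∈ Γ` — brick (B7a-S) «STABLE-TYPES-FIN» (★ (B2) étale `F`-algebras of bounded degree are finitely many + ★ (B4) descent);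
* (NORMS) for each regular `γ₀ ∈ U`, finitely many `⋆`-fixed units of `L[γ₀]` modulo norms `a⋆ a`, `a ∈ L[γ₀]ˣ` — brick (B6) «ETALE-UNIT-SQUARE-CLASSES-FIN» (★ (B1) square
  classes of local fields; `a⋆ a = a²` on the fixed algebra).
From these: **`exists_finset_cartanSubgroups_of_types_of_norms`** — a finite set `S` of Cartan subgroups `Z_U(γᵢ)` such that EVERY Cartan subgroup `Z_U(γ)` (`γ` regular) is
`U`-CONJUGATE to a member of `S`.  PROOF (§§1–3): an iso `Ψ : (L[γ₀], τ₀) ≃ (L[γ], τ)` is `Ad(g)`, `g ∈ GL_N(L)` (★ (B3)); `Ad(g)` is then `⋆`-COMPATIBLE on `L[γ₀]`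
(`hermStar_conj_eq_of_algEquiv`), so `g γ₀ g⁻¹ ∈ U` with `Z_U(g γ₀ g⁻¹) = Z_U(γ)` (★ (B5) `conj_mem_unitaryGroup_of_hermStar_conj`, `centralizer_eq_centralizer_of_mem_adjoin`) and the
class `x_g = g⋆ g ∈ (L[γ₀]^⋆)ˣ` is defined (★ (B5)); two realisations `g, g₁` of the same pair `(γ₀, class mod norms)` give `g = u g₁ c`, `u ∈ U`, `c ∈ L[γ₀]ˣ` (★ (B5)
`exists_unitary_mul_of_hermStar_mul_self_eq_of_mem_cartanAlgebra`), hence `U`-conjugate centralisers (★ `conj_eq_conj_conj_of_eq_mul_mul`, `centralizer_singleton_conj_eq_map`).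
`S` = one centraliser per REALISED pair `(γ₀ ∈ Γ, r ∈ R(γ₀))`.  [Rogawski1990 §3.6 p. 31: four∕two∕one classes per type for `U(3)`; PlatonovRapinchuk1994 §6.4: finiteness in general.]
HC_CM is proved only modulo the printed citations until rung 0 closes; this file is unconditional algebra (count-neutral); (B7b) transports it to `Gqs L v`.

## References
* [Rogawski1990] J. D. Rogawski, *Automorphic Representations of Unitary Groups in Three Variables*, Ann. of Math. Stud. 123 (1990), §3.5 Prop. 3.5.2 p. 29, §3.6 p. 31.
* [PlatonovRapinchuk1994] V. Platonov, A. Rapinchuk, *Algebraic Groups and Number Theory* (1994), §6.4 (Thm. 6.14, Cor. 1: finitely many conjugacy classes of maximal tori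
  over a local field of characteristic zero).
-/

set_option autoImplicit false

noncomputable section

namespace Literature.NumberTheory.Rogawski1990

open scoped MatrixGroups Matrix
open Polynomial
open Literature.AlgebraicGeometry.ShimuraVarieties (unitaryGroup mem_unitaryGroup_iff)
open Literature.LinearAlgebra.Matrix

variable {F L : Type} [Field F] [Field L] [Algebra F L] (σ : L →+* L) {N : ℕ} {H : Matrix (Fin N) (Fin N) L}

/-! ## §1 An involution-preserving isomorphism of Cartan algebras is a `⋆`-compatible conjugation -/

/-- **`Ψ = Ad(g)` intertwining the Cartan involutions makes `g` `⋆`-compatible on `L[γ₀]`**: `(g b g⁻¹)⋆ = g b⋆ g⁻¹` for every `b ∈ L[γ₀]`.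
[cite: Rogawski1990, §3.5 p. 29; §3.6 p. 31] -/
theorem hermStar_conj_eq_of_algEquiv (hσF : ∀ q : F, σ (algebraMap F L q) = algebraMap F L q) (hσσ : ∀ x : L, σ (σ x) = x) (hHdet : IsUnit H.det)
    (hH : (H.map σ)ᵀ = H) {γ₀ γ : Matrix (Fin N) (Fin N) L} (hreg₀ : γ₀.charpoly.Separable) (hγ₀ : (γ₀.map σ)ᵀ * H * γ₀ = H)
    (hreg : γ.charpoly.Separable) (hγ : (γ.map σ)ᵀ * H * γ = H)
    (Ψ : ↥(Algebra.adjoin L ({γ₀} : Set (Matrix (Fin N) (Fin N) L))) ≃ₐ[L] ↥(Algebra.adjoin L ({γ} : Set (Matrix (Fin N) (Fin N) L))))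
    (hΨ : ∀ b, Ψ (cartanInvolution σ hσF hσσ hHdet hH hreg₀ hγ₀ b) = cartanInvolution σ hσF hσσ hHdet hH hreg hγ (Ψ b))
    {g : GL (Fin N) L}
    (hg : ∀ b : ↥(Algebra.adjoin L ({γ₀} : Set (Matrix (Fin N) (Fin N) L))),
      ((Ψ b : ↥(Algebra.adjoin L ({γ} : Set (Matrix (Fin N) (Fin N) L)))) : Matrix (Fin N) (Fin N) L) =
        (g : Matrix (Fin N) (Fin N) L) * (b : Matrix (Fin N) (Fin N) L) * ((g⁻¹ : GL (Fin N) L) : Matrix (Fin N) (Fin N) L))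
    {b : Matrix (Fin N) (Fin N) L} (hb : b ∈ Algebra.adjoin L ({γ₀} : Set (Matrix (Fin N) (Fin N) L))) :
    hermStar σ H ((g : Matrix (Fin N) (Fin N) L) * b * ((g⁻¹ : GL (Fin N) L) : Matrix (Fin N) (Fin N) L)) =
      (g : Matrix (Fin N) (Fin N) L) * hermStar σ H b * ((g⁻¹ : GL (Fin N) L) : Matrix (Fin N) (Fin N) L) := by
  have h1 := hg ⟨b, hb⟩
  have h2 : ((Ψ (cartanInvolution σ hσF hσσ hHdet hH hreg₀ hγ₀ ⟨b, hb⟩) : ↥(Algebra.adjoin L ({γ} : Set (Matrix (Fin N) (Fin N) L)))) : Matrix (Fin N) (Fin N) L) =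
      (g : Matrix (Fin N) (Fin N) L) * hermStar σ H b * ((g⁻¹ : GL (Fin N) L) : Matrix (Fin N) (Fin N) L) := by
    have h := hg (cartanInvolution σ hσF hσσ hHdet hH hreg₀ hγ₀ ⟨b, hb⟩)
    rwa [coe_cartanInvolution] at h
  have h3 : hermStar σ H ((Ψ ⟨b, hb⟩ : ↥(Algebra.adjoin L ({γ} : Set (Matrix (Fin N) (Fin N) L)))) : Matrix (Fin N) (Fin N) L) =
      ((cartanInvolution σ hσF hσσ hHdet hH hreg hγ (Ψ ⟨b, hb⟩) : ↥(Algebra.adjoin L ({γ} : Set (Matrix (Fin N) (Fin N) L)))) : Matrix (Fin N) (Fin N) L) :=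
    (coe_cartanInvolution σ hσF hσσ hHdet hH hreg hγ _).symm
  -- `(g b g⁻¹)⋆ = (Ψ b)⋆ = ↑(τ (Ψ b)) = ↑(Ψ (τ₀ b)) = g b⋆ g⁻¹`
  rw [← h1, h3, ← hΨ, h2]

/-! ## §2 Consequences of `⋆`-compatibility: the transported torus and its class -/

section Transport

variable (H)

/-- `g γ₀ g⁻¹ ∈ U(H)` for `γ₀ ∈ U(H)` and `g` `⋆`-compatible on `L[γ₀]`. [cite: Rogawski1990, §3.6 p. 31] -/
theorem conj_mem_unitaryGroup_of_forall_hermStar_conj (hHdet : IsUnit H.det) {γ₀ : ↥(unitaryGroup σ H)} {g : GL (Fin N) L}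
    (hAd : ∀ b ∈ Algebra.adjoin L ({((γ₀ : GL (Fin N) L) : Matrix (Fin N) (Fin N) L)} : Set (Matrix (Fin N) (Fin N) L)),
      hermStar σ H ((g : Matrix (Fin N) (Fin N) L) * b * ((g⁻¹ : GL (Fin N) L) : Matrix (Fin N) (Fin N) L)) =
        (g : Matrix (Fin N) (Fin N) L) * hermStar σ H b * ((g⁻¹ : GL (Fin N) L) : Matrix (Fin N) (Fin N) L)) :
    g * (γ₀ : GL (Fin N) L) * g⁻¹ ∈ unitaryGroup σ H :=
  conj_mem_unitaryGroup_of_hermStar_conj σ H hHdet γ₀.2 (hAd _ (Algebra.self_mem_adjoin_singleton L _))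

/-- `x_g = g⋆ g` lies in `L[γ₀]`, is `⋆`-fixed and invertible, for `g` `⋆`-compatible on `L[γ₀]` (`γ₀` regular unitary). [cite: Rogawski1990, §3.5 Prop. 3.5.2 p. 29] -/
theorem hermStar_mul_self_mem_adjoin (hσσ : ∀ x : L, σ (σ x) = x) (hHdet : IsUnit H.det) (hH : (H.map σ)ᵀ = H) {γ₀ : ↥(unitaryGroup σ H)}
    (hreg₀ : ((γ₀ : GL (Fin N) L) : Matrix (Fin N) (Fin N) L).charpoly.Separable) {g : GL (Fin N) L}
    (hAd : ∀ b ∈ Algebra.adjoin L ({((γ₀ : GL (Fin N) L) : Matrix (Fin N) (Fin N) L)} : Set (Matrix (Fin N) (Fin N) L)),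
      hermStar σ H ((g : Matrix (Fin N) (Fin N) L) * b * ((g⁻¹ : GL (Fin N) L) : Matrix (Fin N) (Fin N) L)) =
        (g : Matrix (Fin N) (Fin N) L) * hermStar σ H b * ((g⁻¹ : GL (Fin N) L) : Matrix (Fin N) (Fin N) L)) :
    hermStar σ H (g : Matrix (Fin N) (Fin N) L) * (g : Matrix (Fin N) (Fin N) L) ∈
        Algebra.adjoin L ({((γ₀ : GL (Fin N) L) : Matrix (Fin N) (Fin N) L)} : Set (Matrix (Fin N) (Fin N) L)) ∧
      hermStar σ H (hermStar σ H (g : Matrix (Fin N) (Fin N) L) * (g : Matrix (Fin N) (Fin N) L)) =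
        hermStar σ H (g : Matrix (Fin N) (Fin N) L) * (g : Matrix (Fin N) (Fin N) L) ∧
      IsUnit (hermStar σ H (g : Matrix (Fin N) (Fin N) L) * (g : Matrix (Fin N) (Fin N) L)) := by
  have hinv : (((γ₀ : GL (Fin N) L)⁻¹ : GL (Fin N) L) : Matrix (Fin N) (Fin N) L) ∈
      Algebra.adjoin L ({((γ₀ : GL (Fin N) L) : Matrix (Fin N) (Fin N) L)} : Set (Matrix (Fin N) (Fin N) L)) :=
    mem_adjoin_singleton_of_commute _ hreg₀ (Commute.units_inv_right (Commute.refl _))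
  have hx := hermStar_mul_self_mem_cartanAlgebra σ H hHdet hσσ hH γ₀.2 (hAd _ hinv)
  exact ⟨mem_adjoin_singleton_of_commute _ hreg₀ (mem_cartanAlgebra_iff.1 hx).symm, hermStar_hermStar_mul_self σ H hHdet hσσ hH _,
    isUnit_hermStar_mul_self σ H hHdet g⟩

/-- **The transported torus is the Cartan subgroup of the target algebra**: if `Ψ = Ad(g) : L[γ₀] ≃ L[γ]` then `Z_U(γ) = Z_U(g γ₀ g⁻¹)` (both generate the same algebra).
[cite: Rogawski1990, §3.6 p. 31] -/
theorem centralizer_eq_centralizer_conj {γ₀ γ : ↥(unitaryGroup σ H)}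
    (Ψ : ↥(Algebra.adjoin L ({((γ₀ : GL (Fin N) L) : Matrix (Fin N) (Fin N) L)} : Set (Matrix (Fin N) (Fin N) L))) ≃ₐ[L]
      ↥(Algebra.adjoin L ({((γ : GL (Fin N) L) : Matrix (Fin N) (Fin N) L)} : Set (Matrix (Fin N) (Fin N) L))))
    {g : GL (Fin N) L}
    (hg : ∀ b : ↥(Algebra.adjoin L ({((γ₀ : GL (Fin N) L) : Matrix (Fin N) (Fin N) L)} : Set (Matrix (Fin N) (Fin N) L))),
      ((Ψ b : ↥(Algebra.adjoin L ({((γ : GL (Fin N) L) : Matrix (Fin N) (Fin N) L)} : Set (Matrix (Fin N) (Fin N) L)))) : Matrix (Fin N) (Fin N) L) =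
        (g : Matrix (Fin N) (Fin N) L) * (b : Matrix (Fin N) (Fin N) L) * ((g⁻¹ : GL (Fin N) L) : Matrix (Fin N) (Fin N) L))
    (hmem : g * (γ₀ : GL (Fin N) L) * g⁻¹ ∈ unitaryGroup σ H) :
    Subgroup.centralizer ({γ} : Set ↥(unitaryGroup σ H)) = Subgroup.centralizer ({⟨g * (γ₀ : GL (Fin N) L) * g⁻¹, hmem⟩} : Set ↥(unitaryGroup σ H)) := by
  apply centralizer_eq_centralizer_of_mem_adjoin σ H
  · -- `g γ₀ g⁻¹ = Ψ γ₀ ∈ L[γ]`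
    show ((g * (γ₀ : GL (Fin N) L) * g⁻¹ : GL (Fin N) L) : Matrix (Fin N) (Fin N) L) ∈ _
    rw [Units.val_mul, Units.val_mul, ← hg ⟨_, Algebra.self_mem_adjoin_singleton L _⟩]
    exact (Ψ _).2
  · -- `γ = Ψ (Ψ⁻¹ γ) = g p(γ₀) g⁻¹ ∈ L[g γ₀ g⁻¹]`
    set c := Ψ.symm ⟨((γ : GL (Fin N) L) : Matrix (Fin N) (Fin N) L), Algebra.self_mem_adjoin_singleton L _⟩ with hc
    have hγc : ((γ : GL (Fin N) L) : Matrix (Fin N) (Fin N) L) = (g : Matrix (Fin N) (Fin N) L) * (c : Matrix (Fin N) (Fin N) L) * ((g⁻¹ : GL (Fin N) L) : Matrix (Fin N) (Fin N) L) := by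
      rw [← hg c, hc, AlgEquiv.apply_symm_apply]
    -- conjugation by `g` is an algebra hom mapping `L[γ₀]` into `L[g γ₀ g⁻¹]`
    obtain ⟨p, hp⟩ : ∃ p : L[X], aeval ((γ₀ : GL (Fin N) L) : Matrix (Fin N) (Fin N) L) p = (c : Matrix (Fin N) (Fin N) L) :=
      (AlgHom.mem_range _).1 ((Algebra.adjoin_singleton_eq_range_aeval L _).le c.2)
    let κ : Matrix (Fin N) (Fin N) L →ₐ[L] Matrix (Fin N) (Fin N) L :=
      { toFun := fun X => (g : Matrix (Fin N) (Fin N) L) * X * ((g⁻¹ : GL (Fin N) L) : Matrix (Fin N) (Fin N) L)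
        map_one' := by rw [Matrix.mul_one, ← Units.val_mul, mul_inv_cancel, Units.val_one]
        map_mul' := fun X Y => by
          calc (g : Matrix (Fin N) (Fin N) L) * (X * Y) * ((g⁻¹ : GL (Fin N) L) : Matrix (Fin N) (Fin N) L)
              = (g : Matrix (Fin N) (Fin N) L) * X * (((g⁻¹ : GL (Fin N) L) : Matrix (Fin N) (Fin N) L) * (g : Matrix (Fin N) (Fin N) L)) * Y *
                  ((g⁻¹ : GL (Fin N) L) : Matrix (Fin N) (Fin N) L) := by
                rw [← Units.val_mul, inv_mul_cancel, Units.val_one, Matrix.mul_one]; simp only [Matrix.mul_assoc]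
            _ = _ := by simp only [Matrix.mul_assoc]
        map_zero' := by rw [Matrix.mul_zero, Matrix.zero_mul]
        map_add' := fun X Y => by rw [Matrix.mul_add, Matrix.add_mul]
        commutes' := fun k => by
          rw [Algebra.algebraMap_eq_smul_one, Matrix.mul_smul, Matrix.mul_one, Matrix.smul_mul, ← Units.val_mul, mul_inv_cancel, Units.val_one] }
    have hκ : ∀ X, κ X = (g : Matrix (Fin N) (Fin N) L) * X * ((g⁻¹ : GL (Fin N) L) : Matrix (Fin N) (Fin N) L) := fun _ => rfl
    show ((γ : GL (Fin N) L) : Matrix (Fin N) (Fin N) L) ∈ _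
    rw [hγc, ← hp, ← hκ, ← Polynomial.aeval_algHom_apply κ, hκ, Units.val_mul, Units.val_mul]
    exact (Algebra.adjoin_singleton_eq_range_aeval L _).ge (AlgHom.mem_range_self _ p)

end Transport

/-! ## §3 The assembly: finitely many conjugacy classes of Cartan subgroups from (TYPES) + (NORMS) -/

/-- **Finitely many `U(H)`-conjugacy classes of Cartan subgroups, from finitely many involutive Cartan-algebra types and finitely many norm classes.**
`σ` an involution of `L` fixing `F`, `H` invertible `σ`-hermitian; (TYPES), (NORMS) as in the module docstring (the sibling bricks (B7a-S), (B6) of the road).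
Conclusion: a finite set `S` of centralisers of regular elements of `U = U(H)(L)` such that the centraliser of EVERY regular element is `u T u⁻¹` for some `T ∈ S`, `u ∈ U`.
[cite: Rogawski1990, §3.6 p. 31] [cite: PlatonovRapinchuk1994, §6.4 Cor. 1] -/
theorem exists_finset_cartanSubgroups_of_types_of_norms (hσF : ∀ q : F, σ (algebraMap F L q) = algebraMap F L q) (hσσ : ∀ x : L, σ (σ x) = x)
    (hHdet : IsUnit H.det) (hH : (H.map σ)ᵀ = H)
    (hTypes : ∃ Γ : Finset ↥(unitaryGroup σ H), ∀ (γ : ↥(unitaryGroup σ H)) (hreg : ((γ : GL (Fin N) L) : Matrix (Fin N) (Fin N) L).charpoly.Separable),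
      ∃ γ₀ ∈ Γ, ∃ hreg₀ : ((γ₀ : GL (Fin N) L) : Matrix (Fin N) (Fin N) L).charpoly.Separable,
        ∃ Ψ : ↥(Algebra.adjoin L ({((γ₀ : GL (Fin N) L) : Matrix (Fin N) (Fin N) L)} : Set (Matrix (Fin N) (Fin N) L))) ≃ₐ[L]
            ↥(Algebra.adjoin L ({((γ : GL (Fin N) L) : Matrix (Fin N) (Fin N) L)} : Set (Matrix (Fin N) (Fin N) L))),
          ∀ b, Ψ (cartanInvolution σ hσF hσσ hHdet hH hreg₀ (mem_unitaryGroup_iff.1 γ₀.2) b) =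
            cartanInvolution σ hσF hσσ hHdet hH hreg (mem_unitaryGroup_iff.1 γ.2) (Ψ b))
    (hNorms : ∀ (γ₀ : ↥(unitaryGroup σ H)), ((γ₀ : GL (Fin N) L) : Matrix (Fin N) (Fin N) L).charpoly.Separable →
      ∃ R : Finset (Matrix (Fin N) (Fin N) L), ∀ x ∈ Algebra.adjoin L ({((γ₀ : GL (Fin N) L) : Matrix (Fin N) (Fin N) L)} : Set (Matrix (Fin N) (Fin N) L)),
        hermStar σ H x = x → IsUnit x →
          ∃ r ∈ R, ∃ a : GL (Fin N) L, (a : Matrix (Fin N) (Fin N) L) ∈ Algebra.adjoin L ({((γ₀ : GL (Fin N) L) : Matrix (Fin N) (Fin N) L)} : Set (Matrix (Fin N) (Fin N) L)) ∧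
            x = r * (hermStar σ H (a : Matrix (Fin N) (Fin N) L) * (a : Matrix (Fin N) (Fin N) L))) :
    ∃ S : Finset (Subgroup ↥(unitaryGroup σ H)),
      (∀ T ∈ S, ∃ γ₀ : ↥(unitaryGroup σ H), ((γ₀ : GL (Fin N) L) : Matrix (Fin N) (Fin N) L).charpoly.Separable ∧ T = Subgroup.centralizer ({γ₀} : Set ↥(unitaryGroup σ H))) ∧
      ∀ γ : ↥(unitaryGroup σ H), ((γ : GL (Fin N) L) : Matrix (Fin N) (Fin N) L).charpoly.Separable →
        ∃ T ∈ S, ∃ u : ↥(unitaryGroup σ H), Subgroup.centralizer ({γ} : Set ↥(unitaryGroup σ H)) = T.map (MulAut.conj u).toMonoidHom := by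
  classical
  obtain ⟨Γ, hΓ⟩ := hTypes
  choose R hR using hNorms
  -- `⋆`-compatibility of `g` on `L[γ₀]`
  let Comp : ↥(unitaryGroup σ H) → GL (Fin N) L → Prop := fun γ₀ g =>
    ∀ b ∈ Algebra.adjoin L ({((γ₀ : GL (Fin N) L) : Matrix (Fin N) (Fin N) L)} : Set (Matrix (Fin N) (Fin N) L)),
      hermStar σ H ((g : Matrix (Fin N) (Fin N) L) * b * ((g⁻¹ : GL (Fin N) L) : Matrix (Fin N) (Fin N) L)) =
        (g : Matrix (Fin N) (Fin N) L) * hermStar σ H b * ((g⁻¹ : GL (Fin N) L) : Matrix (Fin N) (Fin N) L)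
  -- a pair `(γ₀, r)` is REALISED by `g`: `g` is `⋆`-compatible on `L[γ₀]` and `x_g = r · a⋆a` for some `a ∈ L[γ₀]ˣ`
  let Real : ↥(unitaryGroup σ H) → Matrix (Fin N) (Fin N) L → GL (Fin N) L → Prop := fun γ₀ r g =>
    Comp γ₀ g ∧ ∃ a : GL (Fin N) L, (a : Matrix (Fin N) (Fin N) L) ∈ Algebra.adjoin L ({((γ₀ : GL (Fin N) L) : Matrix (Fin N) (Fin N) L)} : Set (Matrix (Fin N) (Fin N) L)) ∧
      hermStar σ H (g : Matrix (Fin N) (Fin N) L) * (g : Matrix (Fin N) (Fin N) L) = r * (hermStar σ H (a : Matrix (Fin N) (Fin N) L) * (a : Matrix (Fin N) (Fin N) L))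
  -- the representative attached to a pair: the centraliser of `g γ₀ g⁻¹` for a chosen realisation `g` (default `Z(γ₀)` if the pair is not realised)
  let T : ↥(unitaryGroup σ H) → Matrix (Fin N) (Fin N) L → Subgroup ↥(unitaryGroup σ H) := fun γ₀ r =>
    if h : ∃ g, Real γ₀ r g then
      Subgroup.centralizer ({⟨h.choose * (γ₀ : GL (Fin N) L) * h.choose⁻¹, conj_mem_unitaryGroup_of_forall_hermStar_conj σ H hHdet h.choose_spec.1⟩} : Set ↥(unitaryGroup σ H))
    else Subgroup.centralizer ({γ₀} : Set ↥(unitaryGroup σ H))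
  refine ⟨Γ.attach.biUnion (fun γ₀ => if h : ((γ₀.1 : GL (Fin N) L) : Matrix (Fin N) (Fin N) L).charpoly.Separable then (R γ₀.1 h).image (T γ₀.1) else ∅), ?_, ?_⟩
  · -- every member is the centraliser of a regular element
    intro T' hT'
    simp only [Finset.mem_biUnion, Finset.mem_attach, true_and] at hT'
    obtain ⟨γ₀, hγ₀⟩ := hT'
    by_cases hreg₀ : ((γ₀.1 : GL (Fin N) L) : Matrix (Fin N) (Fin N) L).charpoly.Separable
    · rw [dif_pos hreg₀, Finset.mem_image] at hγ₀
      obtain ⟨r, -, rfl⟩ := hγ₀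
      by_cases h : ∃ g, Real γ₀.1 r g
      · refine ⟨⟨h.choose * (γ₀.1 : GL (Fin N) L) * h.choose⁻¹, conj_mem_unitaryGroup_of_forall_hermStar_conj σ H hHdet h.choose_spec.1⟩, ?_, ?_⟩
        · show ((h.choose * (γ₀.1 : GL (Fin N) L) * h.choose⁻¹ : GL (Fin N) L) : Matrix (Fin N) (Fin N) L).charpoly.Separable
          rw [Units.val_mul, Units.val_mul, Matrix.coe_units_inv, Matrix.charpoly_units_conj]
          exact hreg₀
        · exact dif_pos h
      · exact ⟨γ₀.1, hreg₀, dif_neg h⟩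
    · rw [dif_neg hreg₀] at hγ₀
      exact absurd hγ₀ (Finset.notMem_empty _)
  · -- every Cartan subgroup is conjugate to a member
    intro γ hreg
    obtain ⟨γ₀, hγ₀Γ, hreg₀, Ψ, hΨ⟩ := hΓ γ hreg
    -- `Ψ = Ad(g)`
    obtain ⟨g, hg⟩ := exists_gl_conj_eq_algEquiv_adjoin _ hreg₀ _ Ψ
    have hComp : Comp γ₀ g := fun b hb =>
      hermStar_conj_eq_of_algEquiv σ hσF hσσ hHdet hH hreg₀ (mem_unitaryGroup_iff.1 γ₀.2) hreg (mem_unitaryGroup_iff.1 γ.2) Ψ hΨ hg hb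
    obtain ⟨hxmem, hxfix, hxunit⟩ := hermStar_mul_self_mem_adjoin σ H hσσ hHdet hH hreg₀ hComp
    obtain ⟨r, hrR, a, ha, hxr⟩ := hR γ₀ hreg₀ _ hxmem hxfix hxunit
    have hReal : ∃ g', Real γ₀ r g' := ⟨g, hComp, a, ha, hxr⟩
    -- the chosen realisation `g₁` of the pair `(γ₀, r)`
    set g₁ := hReal.choose with hg₁
    obtain ⟨hComp₁, a₁, ha₁, hxr₁⟩ := hReal.choose_spec
    refine ⟨T γ₀ r, Finset.mem_biUnion.2 ⟨⟨γ₀, hγ₀Γ⟩, Finset.mem_attach _ _, by rw [dif_pos hreg₀]; exact Finset.mem_image_of_mem _ hrR⟩, ?_⟩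
    -- `x_g = x_{g₁} · c⋆ c` with `c = a a₁⁻¹ ∈ L[γ₀]`
    have ha₁inv : ((a₁⁻¹ : GL (Fin N) L) : Matrix (Fin N) (Fin N) L) ∈ Algebra.adjoin L ({((γ₀ : GL (Fin N) L) : Matrix (Fin N) (Fin N) L)} : Set (Matrix (Fin N) (Fin N) L)) :=
      mem_adjoin_singleton_of_commute _ hreg₀ (commute_of_mem_adjoin_singleton ha₁).symm.units_inv_right
    have hc : ((a * a₁⁻¹ : GL (Fin N) L) : Matrix (Fin N) (Fin N) L) ∈ Algebra.adjoin L ({((γ₀ : GL (Fin N) L) : Matrix (Fin N) (Fin N) L)} : Set (Matrix (Fin N) (Fin N) L)) := by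
      rw [Units.val_mul]; exact Subalgebra.mul_mem _ ha ha₁inv
    have hcZ : ((a * a₁⁻¹ : GL (Fin N) L) : Matrix (Fin N) (Fin N) L) ∈ cartanAlgebra ((γ₀ : GL (Fin N) L) : Matrix (Fin N) (Fin N) L) :=
      mem_cartanAlgebra_iff.2 (commute_of_mem_adjoin_singleton hc)
    -- all of `a⋆, a, a₁⋆, a₁, a₁⁻¹, …` live in the COMMUTATIVE algebra `L[γ₀]`
    have hcomm : ∀ {x y : Matrix (Fin N) (Fin N) L}, x ∈ Algebra.adjoin L ({((γ₀ : GL (Fin N) L) : Matrix (Fin N) (Fin N) L)} : Set (Matrix (Fin N) (Fin N) L)) →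
        y ∈ Algebra.adjoin L ({((γ₀ : GL (Fin N) L) : Matrix (Fin N) (Fin N) L)} : Set (Matrix (Fin N) (Fin N) L)) → x * y = y * x := fun hx hy =>
      mul_comm_of_mem_cartanAlgebra hreg₀ (mem_cartanAlgebra_iff.2 (commute_of_mem_adjoin_singleton hx)) (mem_cartanAlgebra_iff.2 (commute_of_mem_adjoin_singleton hy))
    have hstar_mem : ∀ {x : Matrix (Fin N) (Fin N) L}, x ∈ Algebra.adjoin L ({((γ₀ : GL (Fin N) L) : Matrix (Fin N) (Fin N) L)} : Set (Matrix (Fin N) (Fin N) L)) →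
        hermStar σ H x ∈ Algebra.adjoin L ({((γ₀ : GL (Fin N) L) : Matrix (Fin N) (Fin N) L)} : Set (Matrix (Fin N) (Fin N) L)) := fun hx =>
      hermAdjoint_mem_adjoin_singleton _ hreg₀ σ hHdet (mem_unitaryGroup_iff.1 γ₀.2) hx
    -- `a⋆ a = (a₁⋆ a₁) · ((a a₁⁻¹)⋆ (a a₁⁻¹))` in the COMMUTATIVE algebra `L[γ₀]`
    have h1 : hermStar σ H (a₁ : Matrix (Fin N) (Fin N) L) * hermStar σ H ((a₁⁻¹ : GL (Fin N) L) : Matrix (Fin N) (Fin N) L) = 1 :=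
      hermStar_mul_hermStar_coe_inv σ H hHdet a₁
    have h2 : (a₁ : Matrix (Fin N) (Fin N) L) * ((a₁⁻¹ : GL (Fin N) L) : Matrix (Fin N) (Fin N) L) = 1 := by
      rw [← Units.val_mul, mul_inv_cancel, Units.val_one]
    have hXYZ : hermStar σ H (a : Matrix (Fin N) (Fin N) L) * (a : Matrix (Fin N) (Fin N) L) =
        hermStar σ H (a₁ : Matrix (Fin N) (Fin N) L) * (a₁ : Matrix (Fin N) (Fin N) L) *
          (hermStar σ H ((a * a₁⁻¹ : GL (Fin N) L) : Matrix (Fin N) (Fin N) L) * ((a * a₁⁻¹ : GL (Fin N) L) : Matrix (Fin N) (Fin N) L)) := by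
      rw [Units.val_mul, hermStar_mul σ H hHdet]
      have hmc : IsMulCommutative ↥(Algebra.adjoin L ({((γ₀ : GL (Fin N) L) : Matrix (Fin N) (Fin N) L)} : Set (Matrix (Fin N) (Fin N) L))) :=
        Algebra.isMulCommutative_adjoin L (fun x hx y hy => by rw [Set.mem_singleton_iff] at hx hy; rw [hx, hy])
      letI : CommRing ↥(Algebra.adjoin L ({((γ₀ : GL (Fin N) L) : Matrix (Fin N) (Fin N) L)} : Set (Matrix (Fin N) (Fin N) L))) :=
        { (inferInstance : Ring ↥(Algebra.adjoin L ({((γ₀ : GL (Fin N) L) : Matrix (Fin N) (Fin N) L)} : Set (Matrix (Fin N) (Fin N) L)))) with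
          mul_comm := fun x y => hmc.is_comm.comm x y }
      have key : (⟨hermStar σ H (a : Matrix (Fin N) (Fin N) L), hstar_mem ha⟩ * ⟨(a : Matrix (Fin N) (Fin N) L), ha⟩ :
            ↥(Algebra.adjoin L ({((γ₀ : GL (Fin N) L) : Matrix (Fin N) (Fin N) L)} : Set (Matrix (Fin N) (Fin N) L)))) =
          (⟨hermStar σ H (a₁ : Matrix (Fin N) (Fin N) L), hstar_mem ha₁⟩ * ⟨(a₁ : Matrix (Fin N) (Fin N) L), ha₁⟩) *
            ((⟨hermStar σ H ((a₁⁻¹ : GL (Fin N) L) : Matrix (Fin N) (Fin N) L), hstar_mem ha₁inv⟩ * ⟨hermStar σ H (a : Matrix (Fin N) (Fin N) L), hstar_mem ha⟩) *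
              (⟨(a : Matrix (Fin N) (Fin N) L), ha⟩ * ⟨((a₁⁻¹ : GL (Fin N) L) : Matrix (Fin N) (Fin N) L), ha₁inv⟩)) := by
        have h1' : (⟨hermStar σ H (a₁ : Matrix (Fin N) (Fin N) L), hstar_mem ha₁⟩ * ⟨hermStar σ H ((a₁⁻¹ : GL (Fin N) L) : Matrix (Fin N) (Fin N) L), hstar_mem ha₁inv⟩ :
            ↥(Algebra.adjoin L ({((γ₀ : GL (Fin N) L) : Matrix (Fin N) (Fin N) L)} : Set (Matrix (Fin N) (Fin N) L)))) = 1 := Subtype.ext h1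
        have h2' : (⟨(a₁ : Matrix (Fin N) (Fin N) L), ha₁⟩ * ⟨((a₁⁻¹ : GL (Fin N) L) : Matrix (Fin N) (Fin N) L), ha₁inv⟩ :
            ↥(Algebra.adjoin L ({((γ₀ : GL (Fin N) L) : Matrix (Fin N) (Fin N) L)} : Set (Matrix (Fin N) (Fin N) L)))) = 1 := Subtype.ext h2
        calc _ = (⟨hermStar σ H (a₁ : Matrix (Fin N) (Fin N) L), hstar_mem ha₁⟩ * ⟨hermStar σ H ((a₁⁻¹ : GL (Fin N) L) : Matrix (Fin N) (Fin N) L), hstar_mem ha₁inv⟩) *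
              (⟨(a₁ : Matrix (Fin N) (Fin N) L), ha₁⟩ * ⟨((a₁⁻¹ : GL (Fin N) L) : Matrix (Fin N) (Fin N) L), ha₁inv⟩) *
              ((⟨hermStar σ H (a : Matrix (Fin N) (Fin N) L), hstar_mem ha⟩ : ↥(Algebra.adjoin L ({((γ₀ : GL (Fin N) L) : Matrix (Fin N) (Fin N) L)} : Set (Matrix (Fin N) (Fin N) L)))) *
                ⟨(a : Matrix (Fin N) (Fin N) L), ha⟩) := by rw [h1', h2', one_mul, one_mul]
          _ = _ := by ring
      exact congrArg Subtype.val key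
    have hkey : hermStar σ H (g : Matrix (Fin N) (Fin N) L) * (g : Matrix (Fin N) (Fin N) L) =
        hermStar σ H (g₁ : Matrix (Fin N) (Fin N) L) * (g₁ : Matrix (Fin N) (Fin N) L) *
          (hermStar σ H ((a * a₁⁻¹ : GL (Fin N) L) : Matrix (Fin N) (Fin N) L) * ((a * a₁⁻¹ : GL (Fin N) L) : Matrix (Fin N) (Fin N) L)) := by
      rw [hxr, hg₁, hxr₁, hXYZ]
      simp only [Matrix.mul_assoc]
    obtain ⟨u, hu, hgu⟩ := exists_unitary_mul_of_hermStar_mul_self_eq_of_mem_cartanAlgebra σ H hHdet hσσ hH γ₀.2 hreg₀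
      (hComp₁ _ (mem_adjoin_singleton_of_commute _ hreg₀ (Commute.units_inv_right (Commute.refl _)))) hcZ hkey
    -- `g γ₀ g⁻¹ = u (g₁ γ₀ g₁⁻¹) u⁻¹`
    have hconj := conj_eq_conj_conj_of_eq_mul_mul (γ₀ := (γ₀ : GL (Fin N) L))
      (Units.ext (commute_of_mem_adjoin_singleton hc).eq : Commute (a * a₁⁻¹) (γ₀ : GL (Fin N) L)) hgu
    refine ⟨⟨u, hu⟩, ?_⟩
    rw [centralizer_eq_centralizer_conj σ H Ψ hg (conj_mem_unitaryGroup_of_forall_hermStar_conj σ H hHdet hComp)]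
    show _ = (T γ₀ r).map _
    simp only [T, dif_pos hReal]
    rw [← centralizer_singleton_conj_eq_map]
    congr 2
    ext1; ext1
    have hconjM := congrArg (fun x : GL (Fin N) L => (x : Matrix (Fin N) (Fin N) L)) hconj
    simp only [Units.val_mul, Matrix.coe_units_inv] at hconjM
    push_cast [Subgroup.coe_mul, Subgroup.coe_inv]
    exact hconjM

end Literature.NumberTheory.Rogawski1990

end
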